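import Summits.SmoothPoincare4.SmoothPoincare4.Theorems.SymplecticOrigamiNoGenusTwoDoorReduction
import Literature.Geometry.Symplectic.McleanDivisorComplementConvexFourProofs
import Literature.Geometry.Symplectic.TaubesCanonicalClassSymplecticCurveFourSplit
import HarnessLib

/-!
# `NoGenusTwoDoor` ⟺ the flat filling exclusion, modulo ONE named fact (line `canonical-cap-filling`,
crux stmt-SmoothPoincare4-7842, lead reshape r3)

Route `SymplecticOrigami`, crux D = `NoGenusTwoDoor` (no closed connected symplectic 4-manifold
`(N, s)` has `(rank H₁, rank H₂) = (2, 1)`).  The sibling file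
`SymplecticOrigamiNoGenusTwoDoorReduction.lean` (p94693, reshape r2, 2026-08-16) reduced the crux to
the line's transfer target C⁺ = FLAT FILLING EXCLUSION (no closed connected symplectic `(N, s)`
contains a smoothly embedded `s`-symplectic genus-2 surface with meridian injectivity whose open
complement is exact, flat and Liouville-packaged) modulo THREE named published facts: Taubes'
canonical-class curve theorem, McLean's convexity of divisor complements, and `K² = 2χ + 3σ` +
adjunction.  Since then McLean's fact has been DISCHARGED in the tree
(`Literature.Geometry.Symplectic.mclean_divisorComplement_convex_four_holds`,
`McleanDivisorComplementConvexFourProofs.lean`, 2026-08-16T21:17Z; McLean 2012, Lemma 5.17 with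
Lemma 5.14), and Taubes' fact has been reduced to exactly its three printed inputs
(`taubes_canonicalClass_symplecticCurve_four_of_split`: Hirzebruch's `c₁² = 2χ + 3σ` for closed
almost complex `4`-manifolds; Taubes 1995 Thm. A (1) for `b⁺ ≥ 2`; Li–Liu 1995 for `b⁺ = 1`).
This file records the sharper reductions (all kernel-checked, no `sorry`):

* `noGenusTwoDoor_of_flatFillingExclusion_of_taubes` — C⁺ ⇒ D modulo ONE named fact,
  `taubes_canonicalClass_symplecticCurve_four` (Taubes–Li–Liu `SW ⇒ Gr` for the canonical class);
* `noGenusTwoDoor_of_flatFillingExclusion_of_printed` — the same modulo the three PRINTED inputs of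
  that fact (Hirzebruch; Taubes 1995; Li–Liu 1995), each a named fact of the tree;
* `stub_reduction_iff_r3` — D ⟺ C⁺ modulo Taubes' fact and `K² = 2χ + 3σ` + adjunction only
  (registered sub-goal of the crux item; the McLean hypothesis of `stub_reduction_iff` is gone).

So after r3 the crux is CLOSED MODULO one named published theorem and the one open statement C⁺
(the line's registered stub `stub_flatFillingExclusion`, ⟺ D; recorded as open: Stipsicz 2002
Rem. 3.4; Kotschick 2006; T.-J. Li 2015 §4.3.1; Akhmedov–Zhang 2015 §2).  Sources: the r2 file,
the skeleton `Cruxes/NoGenusTwoDoor/Lines/canonical_cap_filling.lean` (r3), McLean 2012 L.5.17,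
Taubes 1995 Thm. A (1), Li–Liu 1995.
-/

noncomputable section

-- the prescribed namespace `Summit.<P>.<Sub>.…` duplicates `SmoothPoincare4` (P = Sub)
set_option linter.dupNamespace false

open scoped Manifold ContDiff Topology ContinuousMap
open Set Function TopologicalSpace
open Literature.Geometry.Kaehler (MForm IsSmoothForm IsClosedForm mextDeriv)
open Literature.AlgebraicTopology.SingularHomology
open Literature.Topology.FourManifolds (singularHomologyZ)
open Summit.SmoothPoincare4.SmoothPoincare4.Theses.SymplecticOrigami (NoGenusTwoDoor)

namespace Summit.SmoothPoincare4.SmoothPoincare4.Theorems.NoGenusTwoDoor.CanonicalCapFilling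

/-- **C⁺ ⇒ D modulo Taubes only.** The flat filling exclusion implies `NoGenusTwoDoor`, modulo the
one named fact `taubes_canonicalClass_symplecticCurve_four` (Taubes' canonical-class curve theorem,
with Li–Liu at `b⁺ = 1`): the r2 reduction `noGenusTwoDoor_of_flatFillingExclusion` with its McLean
hypothesis discharged by `mclean_divisorComplement_convex_four_holds` (McLean 2012, Lemma 5.17).
[cite: Mclean2012, Lemma 5.17] -/
theorem noGenusTwoDoor_of_flatFillingExclusion_of_taubes
    (hT : Literature.Geometry.Symplectic.taubes_canonicalClass_symplecticCurve_four)
    (h4 : (∀ (N : Type) [TopologicalSpace N] [T2Space N] [SecondCountableTopology N] [CompactSpace N]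
        [ConnectedSpace N] [ChartedSpace (EuclideanSpace ℝ (Fin 4)) N] [IsManifold (𝓡 4) ∞ N]
        (s : MForm (𝓡 4) N ℝ 2)
        (S : Type) [TopologicalSpace S] [T2Space S] [CompactSpace S] [ConnectedSpace S]
        [ChartedSpace (EuclideanSpace ℝ (Fin 2)) S] [IsManifold (𝓡 2) ∞ S] (b : S → N) (U : Opens N),
        IsSmoothForm s → IsClosedForm s →
        (∀ x (v : TangentSpace (𝓡 4) x), v ≠ 0 → ∃ w, s x ![v, w] ≠ 0) →
        Module.finrank ℤ (singularHomologyZ S 1) = 4 →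
        Manifold.IsSmoothEmbedding (𝓡 2) (𝓡 4) ∞ b →
        (∀ y (v : TangentSpace (𝓡 2) y), v ≠ 0 → ∃ w : TangentSpace (𝓡 2) y,
          s (b y) ![mfderiv (𝓡 2) (𝓡 4) b y v, mfderiv (𝓡 2) (𝓡 4) b y w] ≠ 0) →
        (U : Set N) = (Set.range b)ᶜ →
        Function.Injective (singularHomology.map ℤ ℤ
          (⟨Subtype.val, continuous_subtype_val⟩ : C(↥(Set.range b)ᶜ, N)) 1) →
        (∃ θ : MForm (𝓡 4) U ℝ 1, IsSmoothForm θ ∧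
          mextDeriv θ = s.pullback (𝓡 4) (Subtype.val : U → N)) →
        (∀ x, IsOfFinAddOrder (singularHomology.map ℤ ℤ
          (⟨Subtype.val, continuous_subtype_val⟩ : C(↥(Set.range b)ᶜ, N)) 2 x)) →
        (∀ V : Set N, IsOpen V → Set.range b ⊆ V →
          ∃ (W : Type) (_ : TopologicalSpace W) (_ : T2Space W) (_ : SecondCountableTopology W)
            (_ : CompactSpace W) (_ : ConnectedSpace W) (_ : ChartedSpace (EuclideanHalfSpace 4) W)
            (_ : IsManifold (𝓡∂ 4) ∞ W) (lam : MForm (𝓡∂ 4) W ℝ 1) (ι : W → N),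
            Literature.Geometry.Symplectic.IsLiouvilleDomain W lam ∧
            ContMDiff (𝓡∂ 4) (𝓡 4) ∞ ι ∧ Function.Injective ι ∧
            (∀ x, Function.Injective (mfderiv (𝓡∂ 4) (𝓡 4) ι x)) ∧
            Set.range ι ⊆ (Set.range b)ᶜ ∧ Vᶜ ⊆ Set.range ι ∧
            mextDeriv lam = s.pullback (𝓡∂ 4) ι) →
        False)) :
    NoGenusTwoDoor :=
  noGenusTwoDoor_of_flatFillingExclusion hT
    Literature.Geometry.Symplectic.mclean_divisorComplement_convex_four_holds h4

/-- **C⁺ ⇒ D modulo the three printed inputs of Taubes' fact**: Hirzebruch's `c₁² = 2χ + 3σ` for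
closed almost complex `4`-manifolds (`hirzebruch_firstChernClass_sq_eq_almostComplex_four`), Taubes
1995 Thm. A (1) for `b⁺ ≥ 2` (`taubes1995_hasTaubesCurve_canonicalClass_of_two_le_bPlus`) and its
`b⁺ = 1` companion (`liLiu1995_hasTaubesCurve_canonicalClass_of_bPlus_eq_one`) — via the tree's
assembly `taubes_canonicalClass_symplecticCurve_four_of_split`.
[cite: Taubes1995, Thm. A (1), §3 (3.2), Prop. 4.2] -/
theorem noGenusTwoDoor_of_flatFillingExclusion_of_printed
    (hB : Literature.Geometry.Symplectic.hirzebruch_firstChernClass_sq_eq_almostComplex_four)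
    (hC₂ : Literature.Geometry.Symplectic.taubes1995_hasTaubesCurve_canonicalClass_of_two_le_bPlus)
    (hC₁ : Literature.Geometry.Symplectic.liLiu1995_hasTaubesCurve_canonicalClass_of_bPlus_eq_one)
    (h4 : (∀ (N : Type) [TopologicalSpace N] [T2Space N] [SecondCountableTopology N] [CompactSpace N]
        [ConnectedSpace N] [ChartedSpace (EuclideanSpace ℝ (Fin 4)) N] [IsManifold (𝓡 4) ∞ N]
        (s : MForm (𝓡 4) N ℝ 2)
        (S : Type) [TopologicalSpace S] [T2Space S] [CompactSpace S] [ConnectedSpace S]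
        [ChartedSpace (EuclideanSpace ℝ (Fin 2)) S] [IsManifold (𝓡 2) ∞ S] (b : S → N) (U : Opens N),
        IsSmoothForm s → IsClosedForm s →
        (∀ x (v : TangentSpace (𝓡 4) x), v ≠ 0 → ∃ w, s x ![v, w] ≠ 0) →
        Module.finrank ℤ (singularHomologyZ S 1) = 4 →
        Manifold.IsSmoothEmbedding (𝓡 2) (𝓡 4) ∞ b →
        (∀ y (v : TangentSpace (𝓡 2) y), v ≠ 0 → ∃ w : TangentSpace (𝓡 2) y,
          s (b y) ![mfderiv (𝓡 2) (𝓡 4) b y v, mfderiv (𝓡 2) (𝓡 4) b y w] ≠ 0) →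
        (U : Set N) = (Set.range b)ᶜ →
        Function.Injective (singularHomology.map ℤ ℤ
          (⟨Subtype.val, continuous_subtype_val⟩ : C(↥(Set.range b)ᶜ, N)) 1) →
        (∃ θ : MForm (𝓡 4) U ℝ 1, IsSmoothForm θ ∧
          mextDeriv θ = s.pullback (𝓡 4) (Subtype.val : U → N)) →
        (∀ x, IsOfFinAddOrder (singularHomology.map ℤ ℤ
          (⟨Subtype.val, continuous_subtype_val⟩ : C(↥(Set.range b)ᶜ, N)) 2 x)) →
        (∀ V : Set N, IsOpen V → Set.range b ⊆ V →
          ∃ (W : Type) (_ : TopologicalSpace W) (_ : T2Space W) (_ : SecondCountableTopology W)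
            (_ : CompactSpace W) (_ : ConnectedSpace W) (_ : ChartedSpace (EuclideanHalfSpace 4) W)
            (_ : IsManifold (𝓡∂ 4) ∞ W) (lam : MForm (𝓡∂ 4) W ℝ 1) (ι : W → N),
            Literature.Geometry.Symplectic.IsLiouvilleDomain W lam ∧
            ContMDiff (𝓡∂ 4) (𝓡 4) ∞ ι ∧ Function.Injective ι ∧
            (∀ x, Function.Injective (mfderiv (𝓡∂ 4) (𝓡 4) ι x)) ∧
            Set.range ι ⊆ (Set.range b)ᶜ ∧ Vᶜ ⊆ Set.range ι ∧
            mextDeriv lam = s.pullback (𝓡∂ 4) ι) →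
        False)) :
    NoGenusTwoDoor :=
  noGenusTwoDoor_of_flatFillingExclusion_of_taubes
    (Literature.Geometry.Symplectic.taubes_canonicalClass_symplecticCurve_four_of_split hB hC₂ hC₁) h4

/-- **The transfer is lossless, modulo two facts** (registered sub-goal `stub_reduction_iff_r3` of
the crux item; reshape r3 of `stub_reduction_iff`, whose McLean hypothesis is now discharged):
modulo Taubes' canonical-class curve theorem and `K² = 2χ + 3σ` + adjunction, the crux
`NoGenusTwoDoor` is EQUIVALENT to the flat filling exclusion C⁺ — the one statement left open by
the line `canonical-cap-filling`. [folklore] -/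
theorem stub_reduction_iff_r3 :
    Literature.Geometry.Symplectic.taubes_canonicalClass_symplecticCurve_four →
    Literature.Geometry.Symplectic.canonicalClass_sq_and_adjunction_of_symplectic_four →
    (Summit.SmoothPoincare4.SmoothPoincare4.Theses.SymplecticOrigami.NoGenusTwoDoor ↔
    (∀ (N : Type) [TopologicalSpace N] [T2Space N] [SecondCountableTopology N] [CompactSpace N]
        [ConnectedSpace N] [ChartedSpace (EuclideanSpace ℝ (Fin 4)) N] [IsManifold (𝓡 4) ∞ N]
        (s : MForm (𝓡 4) N ℝ 2)
        (S : Type) [TopologicalSpace S] [T2Space S] [CompactSpace S] [ConnectedSpace S]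
        [ChartedSpace (EuclideanSpace ℝ (Fin 2)) S] [IsManifold (𝓡 2) ∞ S] (b : S → N) (U : Opens N),
        IsSmoothForm s → IsClosedForm s →
        (∀ x (v : TangentSpace (𝓡 4) x), v ≠ 0 → ∃ w, s x ![v, w] ≠ 0) →
        Module.finrank ℤ (singularHomologyZ S 1) = 4 →
        Manifold.IsSmoothEmbedding (𝓡 2) (𝓡 4) ∞ b →
        (∀ y (v : TangentSpace (𝓡 2) y), v ≠ 0 → ∃ w : TangentSpace (𝓡 2) y,
          s (b y) ![mfderiv (𝓡 2) (𝓡 4) b y v, mfderiv (𝓡 2) (𝓡 4) b y w] ≠ 0) →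
        (U : Set N) = (Set.range b)ᶜ →
        Function.Injective (singularHomology.map ℤ ℤ
          (⟨Subtype.val, continuous_subtype_val⟩ : C(↥(Set.range b)ᶜ, N)) 1) →
        (∃ θ : MForm (𝓡 4) U ℝ 1, IsSmoothForm θ ∧
          mextDeriv θ = s.pullback (𝓡 4) (Subtype.val : U → N)) →
        (∀ x, IsOfFinAddOrder (singularHomology.map ℤ ℤ
          (⟨Subtype.val, continuous_subtype_val⟩ : C(↥(Set.range b)ᶜ, N)) 2 x)) →
        (∀ V : Set N, IsOpen V → Set.range b ⊆ V →
          ∃ (W : Type) (_ : TopologicalSpace W) (_ : T2Space W) (_ : SecondCountableTopology W)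
            (_ : CompactSpace W) (_ : ConnectedSpace W) (_ : ChartedSpace (EuclideanHalfSpace 4) W)
            (_ : IsManifold (𝓡∂ 4) ∞ W) (lam : MForm (𝓡∂ 4) W ℝ 1) (ι : W → N),
            Literature.Geometry.Symplectic.IsLiouvilleDomain W lam ∧
            ContMDiff (𝓡∂ 4) (𝓡 4) ∞ ι ∧ Function.Injective ι ∧
            (∀ x, Function.Injective (mfderiv (𝓡∂ 4) (𝓡 4) ι x)) ∧
            Set.range ι ⊆ (Set.range b)ᶜ ∧ Vᶜ ⊆ Set.range ι ∧
            mextDeriv lam = s.pullback (𝓡∂ 4) ι) →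
        False)) :=
  fun hT hA => ⟨flatFillingExclusion_of_noGenusTwoDoor hA,
    noGenusTwoDoor_of_flatFillingExclusion_of_taubes hT⟩

end Summit.SmoothPoincare4.SmoothPoincare4.Theorems.NoGenusTwoDoor.CanonicalCapFilling

end
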